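import Literature.NumberTheory.Sieve.FriedlanderIwaniecPrimesPoisson
import Mathlib.Logic.Equiv.Fin.Basic
import HarnessLib

/-!
# Poisson summation along a progression with a periodic twist (Matomäki–Merikoski, Lemma 3.4)

Topic `Literature/NumberTheory/LFunctions`, sub-namespace `MatomakiMerikoski`. Lemma 3.4 of
K. Matomäki, J. Merikoski, *Siegel zeros, twin primes, Goldbach's conjecture, and primes in short
intervals* (IMRN 2023; arXiv:2112.11412), §3.3 "Poisson summation", is the version of the Poisson
summation formula used in the proofs of their Lemma 3.8 (incomplete Kloosterman sums) and
Proposition 2.3 (§5): "Let `b ∈ ℤ`, `d, q ∈ ℕ` with `(d, bq) = 1`, let `f : ℝ → ℂ` be such that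
`f, f̂ ∈ L¹(ℝ)` and have bounded variation. Let `g : ℝ → ℂ` be `q`-periodic. Then
`∑_{m ≡ b (mod d)} f(m) g(m) = (1/(dq)) ∑_h f̂(h/(dq)) ∑_{m (mod dq), m ≡ b (mod d)} g(m) e(hm/(dq))`."
This file PROVES it for smooth compactly supported `f` (the generality in which it is applied in
the source: `f = F(·/N)` with `F` smooth and compactly supported), with `f̂ = 𝓕 f`, Mathlib's
Fourier transform `𝓕 f(ξ) = ∫ f(t) e(−tξ) dt` (the source's normalisation), the progression
`m = b + dk`, `k ∈ ℤ`, and the residues `m (mod dq)` with `m ≡ b (mod d)` parametrised as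
`m = b + dj`, `0 ≤ j < q`. The coprimality hypothesis `(d, bq) = 1` of the source is not needed
for the identity (it is only used there to rewrite the inner sum by the Chinese remainder theorem)
and is dropped. Everything is PROVED (theorems only, no new definitions):

* `tsum_int_eq_sum_range_tsum` — splitting a summable series over `ℤ` into residue classes:
  `∑_{k ∈ ℤ} F(k) = ∑_{0 ≤ j < q} ∑_{k ∈ ℤ} F(j + qk)`;
* `summable_fourierChar_mul_fourier_div` — summability of `h ↦ e(αh/D) 𝓕f(h/D)`;
* `MatomakiMerikoski2023_lemma34` — **Lemma 3.4**:
  `∑_{k ∈ ℤ} f(b + dk) g(b + dk) = (dq)⁻¹ ∑_{h ∈ ℤ} 𝓕f(h/(dq)) ∑_{0 ≤ j < q} g(b + dj) e(h(b + dj)/(dq))`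
  for `g : ℤ → ℂ` with `g(m + qn) = g(m)`, from the tree's Poisson summation along a progression
  (`FriedlanderIwaniecPrimes.tsum_arithProg_eq_tsum_fourier`, modulus `dq`, one class `b + dj`
  at a time);
* `fourier_comp_div`, `MatomakiMerikoski2023_lemma34_scaled` — the same with `f = F(·/N)`,
  `𝓕f(ξ) = N 𝓕F(Nξ)` (the form "`= (N/(dq)) ∑_h F̂(hN/(dq)) ∑ …`" opening the proof of Lemma 3.8).

## References

* K. Matomäki, J. Merikoski, IMRN 2023:23, 20337–20384 (arXiv:2112.11412), §3.3, Lemma 3.4 and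
  its proof; first display of the proof of Lemma 3.8 (§3.5). [cite: MatomakiMerikoski2023, Lemma 3.4]
* H. Iwaniec, E. Kowalski, *Analytic Number Theory*, AMS Colloquium Publ. 53 (2004), §4.3
  (Poisson summation; the source's reference [IwKo]). [cite: IwaniecKowalski2004, §4.3]
-/

noncomputable section

open Real MeasureTheory Filter Complex Finset
open scoped FourierTransform Topology ContDiff

namespace Literature.NumberTheory.LFunctions.MatomakiMerikoski

open Literature.NumberTheory.Sieve.FriedlanderIwaniecPrimes (tsum_arithProg_eq_tsum_fourier
  norm_fourier_div_le fourier_comp_affine)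

/-! ### Splitting a series over `ℤ` into residue classes -/

/-- **`∑_{k ∈ ℤ} F(k) = ∑_{0 ≤ j < q} ∑_{k ∈ ℤ} F(j + qk)`** for a summable `F : ℤ → ℂ` and `q ≥ 1`
(reindex by `ℤ ≃ ℤ × Fin q`, `k ↦ (k / q, k mod q)`, Mathlib's `Int.divModEquiv`). [folklore] -/
theorem tsum_int_eq_sum_range_tsum (F : ℤ → ℂ) (hF : Summable F) {q : ℕ} (hq : 0 < q) :
    ∑' k : ℤ, F k = ∑ j ∈ Finset.range q, ∑' k : ℤ, F (j + q * k) := by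
  haveI : NeZero q := ⟨hq.ne'⟩
  -- the equivalence `Fin q × ℤ ≃ ℤ`, `(j, k) ↦ k * q + j`
  set e : Fin q × ℤ ≃ ℤ := (Equiv.prodComm (Fin q) ℤ).trans (Int.divModEquiv q).symm with he
  have he_apply : ∀ p : Fin q × ℤ, e p = p.2 * q + (p.1 : ℕ) := by
    intro p
    simp [he, Int.divModEquiv]
  have h1 : ∑' k : ℤ, F k = ∑' p : Fin q × ℤ, F (e p) := (Equiv.tsum_eq e F).symm
  have hsum : Summable (fun p : Fin q × ℤ => F (e p)) := (Equiv.summable_iff e).mpr hF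
  have hfib : ∀ j : Fin q, Summable fun k : ℤ => F (e (j, k)) := by
    intro j
    have hinj : Function.Injective (fun k : ℤ => e (j, k)) := by
      intro k₁ k₂ h
      have := e.injective h
      simpa using this
    exact hF.comp_injective hinj
  rw [h1, hsum.tsum_prod' hfib, tsum_fintype, ← Fin.sum_univ_eq_sum_range]
  refine Finset.sum_congr rfl fun j _ => tsum_congr fun k => ?_
  rw [he_apply]
  congr 1
  push_cast
  ring

/-! ### Summability of the twisted Fourier coefficients -/

/-- For smooth compactly supported `f` and `D > 0`, `h ↦ e(αh/D) 𝓕f(h/D)` is summable over `ℤ`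
(`|𝓕f(h/D)| ≪ h⁻²`, the tree's `FriedlanderIwaniecPrimes.norm_fourier_div_le`). [folklore] -/
theorem summable_fourierChar_mul_fourier_div {f : ℝ → ℂ} (hf : ContDiff ℝ ∞ f)
    (hfc : HasCompactSupport f) {D : ℝ} (hD : 0 < D) (α : ℝ) :
    Summable fun h : ℤ => (𝐞 (α * h / D) : ℂ) * 𝓕 f ((h : ℝ) / D) := by
  refine summable_of_isBigO (Real.summable_abs_int_rpow one_lt_two) ?_
  refine Asymptotics.IsBigO.of_bound ((∫ t, ‖iteratedDeriv 2 f t‖) * (D / (2 * π)) ^ 2) ?_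
  have hmem : {k : ℤ | k ≤ -1 ∨ 1 ≤ k} ∈ (cofinite : Filter ℤ) := by
    rw [Int.cofinite_eq, Filter.mem_sup]
    exact ⟨Filter.mem_of_superset (Filter.mem_atBot (-1)) fun k hk => Or.inl hk,
      Filter.mem_of_superset (Filter.mem_atTop 1) fun k hk => Or.inr hk⟩
  filter_upwards [hmem] with k hk
  have hk0 : 0 < |(k : ℝ)| := by
    rcases hk with h | h
    · have : (k : ℝ) ≤ -1 := by exact_mod_cast h
      rw [abs_pos]; linarith
    · have : (1 : ℝ) ≤ k := by exact_mod_cast h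
      rw [abs_pos]; linarith
  rw [norm_mul, Circle.norm_coe, one_mul]
  refine (norm_fourier_div_le hf hfc 2 hD hk0).trans (le_of_eq ?_)
  rw [Real.norm_eq_abs, abs_of_pos (Real.rpow_pos_of_pos hk0 _), Real.rpow_neg hk0.le,
    Real.rpow_two]

/-- A compactly supported `f : ℝ → ℂ` vanishes outside some ball: `∃ R, |x| > R → f x = 0`.
[folklore] -/
theorem exists_eq_zero_of_hasCompactSupport {f : ℝ → ℂ} (hfc : HasCompactSupport f) :
    ∃ R : ℝ, ∀ x : ℝ, R < |x| → f x = 0 := by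
  obtain ⟨R, hR⟩ := (hfc.isCompact.isBounded).subset_closedBall 0
  refine ⟨R, fun x hx => ?_⟩
  have hx' : x ∉ tsupport f := by
    intro h
    have := hR h
    rw [Metric.mem_closedBall, dist_zero_right, Real.norm_eq_abs] at this
    linarith
  exact image_eq_zero_of_notMem_tsupport hx'

/-- Along a progression `k ↦ b + dk` (`d ≥ 1`) a compactly supported `f` gives a finitely
supported, hence summable, sequence `k ↦ f(b + dk) c(k)`. [folklore] -/
theorem summable_comp_progression_mul {f : ℝ → ℂ} (hfc : HasCompactSupport f) {d : ℕ}
    (hd : 0 < d) (b : ℤ) (c : ℤ → ℂ) :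
    Summable fun k : ℤ => f (b + d * k) * c k := by
  obtain ⟨R, hR⟩ := exists_eq_zero_of_hasCompactSupport hfc
  have hdr : (0 : ℝ) < d := by exact_mod_cast hd
  apply summable_of_hasFiniteSupport
  -- the support is contained in the finite set `{k : |k| ≤ R + |b|}`
  refine ((Finset.Icc (-⌈R + |(b : ℝ)|⌉) ⌈R + |(b : ℝ)|⌉).finite_toSet).subset ?_
  intro k hk
  rw [Function.mem_support] at hk
  have hfk : f (b + d * k) ≠ 0 := left_ne_zero_of_mul hk
  have habs : |((b : ℝ) + d * k)| ≤ R := by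
    by_contra h
    exact hfk (hR _ (not_le.mp h))
  have hk1 : |(k : ℝ)| ≤ R + |(b : ℝ)| := by
    have h1 : |(d : ℝ) * k| ≤ |((b : ℝ) + d * k)| + |(b : ℝ)| := by
      have := abs_sub ((b : ℝ) + d * k) b
      simpa using this
    rw [abs_mul, abs_of_pos hdr] at h1
    have h2 : |(k : ℝ)| ≤ (d : ℝ) * |(k : ℝ)| := by
      have : (1 : ℝ) ≤ d := by exact_mod_cast hd
      nlinarith [abs_nonneg (k : ℝ)]
    linarith
  simp only [Finset.coe_Icc, Set.mem_Icc]
  have hceil : R + |(b : ℝ)| ≤ ⌈R + |(b : ℝ)|⌉ := Int.le_ceil _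
  constructor
  · have : -(⌈R + |(b : ℝ)|⌉ : ℝ) ≤ k := by linarith [neg_abs_le (k : ℝ)]
    exact_mod_cast this
  · have : (k : ℝ) ≤ ⌈R + |(b : ℝ)|⌉ := by linarith [le_abs_self (k : ℝ)]
    exact_mod_cast this

/-! ### Lemma 3.4 -/

/-- **Matomäki–Merikoski 2023, Lemma 3.4** (Poisson summation along a progression with a periodic
twist), for smooth compactly supported `f : ℝ → ℂ`, `d, q ≥ 1`, `b ∈ ℤ` and `g : ℤ → ℂ` with
period `q` (`g(m + qn) = g(m)`):
`∑_{k ∈ ℤ} f(b + dk) g(b + dk) = (dq)⁻¹ ∑_{h ∈ ℤ} 𝓕f(h/(dq)) ∑_{0 ≤ j < q} g(b + dj) e(h(b + dj)/(dq))`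
("`∑_{m ≡ b (mod d)} f(m)g(m) = (1/(dq)) ∑_h f̂(h/(dq)) ∑_{m (mod dq), m ≡ b (mod d)} g(m) e(hm/(dq))`";
the residues `m (mod dq)` with `m ≡ b (mod d)` are the `b + dj`, `0 ≤ j < q`). Proof as printed:
split `k = j + qk'`, apply Poisson summation along `m = (b + dj) + (dq)k'`
(`FriedlanderIwaniecPrimes.tsum_arithProg_eq_tsum_fourier`) and interchange the finite sum with
the sum over `h`. [cite: MatomakiMerikoski2023, Lemma 3.4] -/
theorem MatomakiMerikoski2023_lemma34 {f : ℝ → ℂ} (hf : ContDiff ℝ ∞ f)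
    (hfc : HasCompactSupport f) {d q : ℕ} (hd : 0 < d) (hq : 0 < q) (b : ℤ) {g : ℤ → ℂ}
    (hg : ∀ m n : ℤ, g (m + q * n) = g m) :
    ∑' k : ℤ, f (b + d * k) * g (b + d * k) =
      ((d * q : ℕ) : ℂ)⁻¹ * ∑' h : ℤ, 𝓕 f ((h : ℝ) / (d * q : ℕ)) *
        ∑ j ∈ Finset.range q, g (b + d * j) * (𝐞 (((b + d * j : ℤ) : ℝ) * h / (d * q : ℕ)) : ℂ) := by
  have hdq : 0 < d * q := Nat.mul_pos hd hq
  have hdqr : (0 : ℝ) < (d * q : ℕ) := by exact_mod_cast hdq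
  -- Step 1: split `k = j + q k'`
  rw [tsum_int_eq_sum_range_tsum _ (summable_comp_progression_mul hfc hd b _) hq]
  -- Step 2: Poisson summation in each class
  have hclass : ∀ j ∈ Finset.range q,
      ∑' k : ℤ, f (b + d * (((j : ℤ) + q * k : ℤ) : ℝ)) * g (b + d * ((j : ℤ) + q * k)) =
        g (b + d * j) * (((d * q : ℕ) : ℂ)⁻¹ * ∑' h : ℤ,
          (𝐞 (((b + d * j : ℤ) : ℝ) * h / (d * q : ℕ)) : ℂ) * 𝓕 f ((h : ℝ) / (d * q : ℕ))) := by
    intro j _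
    have hper : ∀ k : ℤ, g (b + d * ((j : ℤ) + q * k)) = g (b + d * j) := by
      intro k
      have : b + d * ((j : ℤ) + q * k) = (b + d * j) + q * (d * k) := by ring
      rw [this, hg]
    have harg : ∀ k : ℤ, ((b + d * ((j : ℤ) + q * k) : ℤ) : ℝ) =
        ((b + d * j : ℤ) : ℝ) + ((d * q : ℕ) : ℝ) * (k : ℝ) := by
      intro k; push_cast; ring
    have hP := tsum_arithProg_eq_tsum_fourier hf hfc hdq (b + d * j)
    calc ∑' k : ℤ, f (b + d * (((j : ℤ) + q * k : ℤ) : ℝ)) * g (b + d * ((j : ℤ) + q * k))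
        = ∑' k : ℤ, f (((b + d * j : ℤ) : ℝ) + ((d * q : ℕ) : ℝ) * k) * g (b + d * j) := by
          refine tsum_congr fun k => ?_
          rw [hper, ← harg]
          push_cast
          ring_nf
      _ = (∑' k : ℤ, f (((b + d * j : ℤ) : ℝ) + ((d * q : ℕ) : ℝ) * k)) * g (b + d * j) :=
          tsum_mul_right
      _ = g (b + d * j) * (((d * q : ℕ) : ℂ)⁻¹ * ∑' h : ℤ,
            (𝐞 (((b + d * j : ℤ) : ℝ) * h / (d * q : ℕ)) : ℂ) * 𝓕 f ((h : ℝ) / (d * q : ℕ))) := by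
          rw [hP, mul_comm]
  rw [Finset.sum_congr rfl hclass]
  -- Step 3: interchange the finite sum over `j` with the sum over `h`
  have hsumm : ∀ j ∈ Finset.range q, Summable fun h : ℤ =>
      g (b + d * j) * ((𝐞 (((b + d * j : ℤ) : ℝ) * h / (d * q : ℕ)) : ℂ) *
        𝓕 f ((h : ℝ) / (d * q : ℕ))) := fun j _ =>
    (summable_fourierChar_mul_fourier_div hf hfc hdqr _).mul_left _
  calc ∑ j ∈ Finset.range q, g (b + d * j) * (((d * q : ℕ) : ℂ)⁻¹ * ∑' h : ℤ,
          (𝐞 (((b + d * j : ℤ) : ℝ) * h / (d * q : ℕ)) : ℂ) * 𝓕 f ((h : ℝ) / (d * q : ℕ)))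
      = ((d * q : ℕ) : ℂ)⁻¹ * ∑ j ∈ Finset.range q, ∑' h : ℤ,
          g (b + d * j) * ((𝐞 (((b + d * j : ℤ) : ℝ) * h / (d * q : ℕ)) : ℂ) *
            𝓕 f ((h : ℝ) / (d * q : ℕ))) := by
        rw [Finset.mul_sum]
        refine Finset.sum_congr rfl fun j _ => ?_
        rw [tsum_mul_left]
        ring
    _ = ((d * q : ℕ) : ℂ)⁻¹ * ∑' h : ℤ, ∑ j ∈ Finset.range q,
          g (b + d * j) * ((𝐞 (((b + d * j : ℤ) : ℝ) * h / (d * q : ℕ)) : ℂ) *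
            𝓕 f ((h : ℝ) / (d * q : ℕ))) := by
        rw [Summable.tsum_finsetSum hsumm]
    _ = _ := by
        congr 1
        refine tsum_congr fun h => ?_
        rw [Finset.mul_sum]
        refine Finset.sum_congr rfl fun j _ => ?_
        ring

/-! ### The scaled form `f = F(·/N)` -/

/-- The Fourier transform of a dilate: `𝓕(F(·/N))(ξ) = N 𝓕F(Nξ)` for `N > 0`. [folklore] -/
theorem fourier_comp_div (F : ℝ → ℂ) {N : ℝ} (hN : 0 < N) (ξ : ℝ) :
    𝓕 (fun x : ℝ => F (x / N)) ξ = (N : ℂ) * 𝓕 F (N * ξ) := by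
  have h := fourier_comp_affine F (d := N⁻¹) (inv_pos.mpr hN) 0 ξ
  have hfun : (fun u : ℝ => F (0 + N⁻¹ * u)) = fun x : ℝ => F (x / N) := by
    funext u; rw [zero_add, div_eq_inv_mul]
  rw [hfun] at h
  rw [h, zero_mul, zero_div, AddChar.map_zero_eq_one, Circle.coe_one, mul_one, Complex.ofReal_inv,
    inv_inv, div_inv_eq_mul, mul_comm ξ N]

/-- **Lemma 3.4 for `f = F(·/N)`** (`F` smooth compactly supported, `N > 0`): the first display of
the proof of Lemma 3.8,
`∑_{k} F((b + dk)/N) g(b + dk) = (N/(dq)) ∑_h 𝓕F(hN/(dq)) ∑_{0 ≤ j < q} g(b + dj) e(h(b + dj)/(dq))`.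
[cite: MatomakiMerikoski2023, Lemma 3.4 and proof of Lemma 3.8] -/
theorem MatomakiMerikoski2023_lemma34_scaled {F : ℝ → ℂ} (hF : ContDiff ℝ ∞ F)
    (hFc : HasCompactSupport F) {N : ℝ} (hN : 0 < N) {d q : ℕ} (hd : 0 < d) (hq : 0 < q)
    (b : ℤ) {g : ℤ → ℂ} (hg : ∀ m n : ℤ, g (m + q * n) = g m) :
    ∑' k : ℤ, F ((b + d * k) / N) * g (b + d * k) =
      (N : ℂ) / ((d * q : ℕ) : ℂ) * ∑' h : ℤ, 𝓕 F (N * h / (d * q : ℕ)) *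
        ∑ j ∈ Finset.range q, g (b + d * j) * (𝐞 (((b + d * j : ℤ) : ℝ) * h / (d * q : ℕ)) : ℂ) := by
  set f : ℝ → ℂ := fun x => F (x / N) with hf_def
  have hf : ContDiff ℝ ∞ f := hF.comp (contDiff_id.div_const N)
  have hfc : HasCompactSupport f := by
    have h := hFc.comp_homeomorph (Homeomorph.mulRight₀ N⁻¹ (inv_ne_zero hN.ne'))
    have hfeq : f = F ∘ ⇑(Homeomorph.mulRight₀ N⁻¹ (inv_ne_zero hN.ne')) := by
      funext x; simp [hf_def, div_eq_mul_inv]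
    rw [hfeq]; exact h
  have h34 := MatomakiMerikoski2023_lemma34 hf hfc hd hq b hg
  have hlhs : (fun k : ℤ => f (b + d * k) * g (b + d * k)) =
      fun k : ℤ => F ((b + d * k) / N) * g (b + d * k) := rfl
  rw [hlhs] at h34
  rw [h34, ← tsum_mul_left, ← tsum_mul_left]
  refine tsum_congr fun h => ?_
  rw [hf_def, fourier_comp_div F hN]
  have : (N : ℂ) / ((d * q : ℕ) : ℂ) = ((d * q : ℕ) : ℂ)⁻¹ * N := by ring
  rw [this, show N * ((h : ℝ) / ((d * q : ℕ) : ℝ)) = N * h / (d * q : ℕ) by ring]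
  ring

end Literature.NumberTheory.LFunctions.MatomakiMerikoski
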